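import Mathlib
import Summits.PneNP.PneNP.Theorems.ConstantBand.Negative.LoadBearing
import Summits.PneNP.PneNP.Theorems.SingleThreshold.Negative.LoadBearing
import Summits.PneNP.PneNP.Theorems.OneSliceBandImpliesThresholdBinomial

/-!
# Route OneSlice — support item `BandImpliesThreshold` (stmt-PneNP-2839)

`Summit.PneNP.PneNP.Theses.OneSlice.BandImpliesThreshold : ConstantBand → SingleThreshold`:
accuracy on the critical Erdős–Rényi graph `G(n, p)`, `p = n^{-2/(k-1)}`, forces accuracy on
some band of `2w+1` adjacent central Hamming slices, so the constant-width rung of the ladder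
implies Rossman's single-threshold rung.

Proof (the route's plan; elementary, no CLT). `ConstantBand` gives `k ≥ 3`, `w`, `δ > 0`. With
`N = C(n,2)`, `μ = N p`, `m = ⌊μ⌋₊ = m_k(n)`, `b i = C(N,i) p^i (1-p)^{N-i}`, `f i` = error fraction
on slice `i`: `err(C) = ∑_{i ≤ N} b i · f i` (`sum_binomialWeight_mul_errFrac`); eventually in `n`
(`eventually_window`) Chebyshev puts `b`-mass `≥ 1/2` on the central `|i - m| ≤ m^{3/4}`
(`half_le_sum_central`) and `b j ≤ 2^w b i` for `j` central, `|i - j| ≤ w`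
(`binomialWeight_central_le`); weighted averaging (`exists_mem_band_sum_le`) gives a central `j`
with band error `≤ 2^{w+1}(2w+1) err(C)`, so `δ' = δ / (2^{w+1}(2w+1))` (`lowerBoundAt_of_bandLB`).

Vocabulary (`thr`, `Central`, `slice`, `errSet`, `bandErr`, `BandLB`, `pc`, `err`, `LowerBoundAt`,
the `Iff.rfl` bridges) from the two `Negative/LoadBearing.lean` files of the cruxes #2, #3.

References: B. Rossman, FOCS 2010 / SICOMP 43 (2014), §9; S. Jukna, *Extremal Combinatorics* (2011).
-/

set_option linter.dupNamespace false -- `Summit.PneNP.PneNP.…`: summit = sub-problem (D-0017)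

namespace Summit.PneNP.PneNP.Theorems

open Literature.Computability.Complexity Finset Filter Classical
open Summit.PneNP.PneNP.Theorems.ConstantBand.Negative (Edge thr Central errSet bandErr BandLB
  constantBand_iff)
open Summit.PneNP.PneNP.Theorems.SingleThreshold.Negative (pc err LowerBoundAt
  singleThreshold_iff_lib tendsto_pc)

noncomputable section

/-! ### Regrouping the `G(n,p)` error by edge count -/

/-- A Hamming slice of the edge cube has `C(C(n,2), i)` elements. [folklore] -/
theorem card_slice (n i : ℕ) : #(ConstantBand.Negative.slice n i) = (n.choose 2).choose i := by
  classical
  unfold ConstantBand.Negative.slice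
  rw [← card_edgeSet_top_fin n, ← card_univ, ← card_powersetCard]
  refine card_nbij' (fun x => univ.filter fun e => x e = true) (fun s e => decide (e ∈ s))
    ?_ ?_ ?_ ?_
  · intro x hx
    rw [mem_coe, mem_filter] at hx
    rw [mem_coe, mem_powersetCard]
    exact ⟨subset_univ _, hx.2⟩
  · intro s hs
    rw [mem_coe, mem_powersetCard] at hs
    rw [mem_coe, mem_filter]
    refine ⟨mem_univ _, ?_⟩
    rw [← hs.2, edgeCount]
    congr 1
    ext e
    simp
  · intro x _; funext e; by_cases h : x e = true <;> simp [h]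
  · intro s _; ext e; simp

/-- Regrouping a `G(n,q)`-probability by edge count:
`Pr[G(n,q) ∈ B] = ∑_{i ≤ C(n,2)} #{x ∈ B : e(x) = i} · q^i (1-q)^{C(n,2)-i}`. [folklore] -/
theorem gnpProb_eq_sum_card_level (n : ℕ) (q : ℝ) (B : Finset (Edge n → Bool)) :
    gnpProb n q B = ∑ i ∈ range (n.choose 2 + 1),
      (#(B.filter fun x => edgeCount x = i) : ℝ) * (q ^ i * (1 - q) ^ (n.choose 2 - i)) := by
  unfold gnpProb
  rw [← sum_fiberwise_of_maps_to (g := edgeCount) (t := range (n.choose 2 + 1))]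
  · refine sum_congr rfl fun i _ => ?_
    rw [sum_congr rfl fun x hx => by rw [gnpWeight, (mem_filter.1 hx).2], sum_const, nsmul_eq_mul]
  · intro x _
    rw [mem_range, Nat.lt_succ_iff, edgeCount, ← card_edgeSet_top_fin n, ← card_univ]
    exact card_filter_le _ _

/-- The error set on slice `i` is the slice-`i` part of the error set. [folklore] -/
theorem errSet_eq_filter (n k i : ℕ) (C : Circuit (Edge n)) :
    errSet n k i C =
      (univ.filter fun x : Edge n → Bool => C.eval x ≠ cliqueFn n k x).filter
        fun x => edgeCount x = i := by
  ext x
  simp only [errSet, mem_filter, mem_univ, true_and]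
  tauto

/-- **`err = ∑ b i · f i`**: the `G(n,q)`-error of `C` is the binomial mixture of its slice error
fractions. [folklore] -/
theorem sum_binomialWeight_mul_errFrac (n k : ℕ) (q : ℝ) (C : Circuit (Edge n)) :
    ∑ i ∈ range (n.choose 2 + 1),
        ((n.choose 2).choose i : ℝ) * q ^ i * (1 - q) ^ (n.choose 2 - i) *
          ((#(errSet n k i C) : ℝ) / (#(ConstantBand.Negative.slice n i) : ℝ)) =
      gnpProb n q (univ.filter fun x : Edge n → Bool => C.eval x ≠ cliqueFn n k x) := by
  rw [gnpProb_eq_sum_card_level]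
  refine sum_congr rfl fun i hi => ?_
  rw [card_slice, ← errSet_eq_filter]
  have hpos : ((n.choose 2).choose i : ℝ) ≠ 0 := by
    have : 0 < (n.choose 2).choose i :=
      Nat.choose_pos (Nat.lt_succ_iff.1 (mem_range.1 hi))
    positivity
  field_simp

/-! ### The asymptotic window -/

/-- `μ = C(n,2) n^{-2/(k-1)} ≥ (n-1)/2` for `k ≥ 3`, `n ≥ 1`. [folklore] -/
theorem mean_ge {k n : ℕ} (hk : 3 ≤ k) (hn : 1 ≤ n) :
    ((n : ℝ) - 1) / 2 ≤ ((n.choose 2 : ℕ) : ℝ) * pc n k := by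
  have hn1 : (1 : ℝ) ≤ n := by exact_mod_cast hn
  have hn0 : (0 : ℝ) < n := by linarith
  have hk' : (3 : ℝ) ≤ k := by exact_mod_cast hk
  have hexp : (-1 : ℝ) ≤ -(2 : ℝ) / ((k : ℝ) - 1) := by
    rw [neg_div, neg_le_neg_iff, div_le_one (by linarith)]
    linarith
  have h1 : (n : ℝ)⁻¹ ≤ pc n k := by
    rw [← Real.rpow_neg_one]
    exact Real.rpow_le_rpow_of_exponent_le hn1 hexp
  rw [Nat.cast_choose_two]
  calc ((n : ℝ) - 1) / 2 = (n : ℝ) * ((n : ℝ) - 1) / 2 * (n : ℝ)⁻¹ := by field_simp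
    _ ≤ (n : ℝ) * ((n : ℝ) - 1) / 2 * pc n k :=
        mul_le_mul_of_nonneg_left h1 (by nlinarith)

/-- `μ_n = C(n,2) n^{-2/(k-1)} → ∞` for `k ≥ 3`. [folklore] -/
theorem tendsto_mean {k : ℕ} (hk : 3 ≤ k) :
    Tendsto (fun n : ℕ => ((n.choose 2 : ℕ) : ℝ) * pc n k) atTop atTop := by
  have h1 : Tendsto (fun n : ℕ => ((n : ℝ) - 1) / 2) atTop atTop := by
    refine Tendsto.atTop_div_const (by norm_num) ?_
    exact tendsto_atTop_add_const_right _ _ tendsto_natCast_atTop_atTop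
  refine tendsto_atTop_mono' _ ?_ h1
  filter_upwards [eventually_ge_atTop 1] with n hn
  exact mean_ge hk hn

/-- **The window, eventually.** For `k ≥ 3` and fixed `w`, eventually in `n`: `0 < p ≤ 1/8`,
`m^{3/4} ≥ 2`, `8μ ≤ m^{3/2}` and `m^{3/4} + w + 1 ≤ μ/4` (`p = n^{-2/(k-1)}`, `μ = C(n,2) p`,
`m = ⌊μ⌋₊`). [folklore] -/
theorem eventually_window {k : ℕ} (hk : 3 ≤ k) (w : ℕ) :
    ∀ᶠ n : ℕ in atTop, 0 < pc n k ∧ pc n k ≤ 1 / 8 ∧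
      (2 : ℝ) ≤ (thr k n : ℝ) ^ ((3 : ℝ) / 4) ∧
      8 * (((n.choose 2 : ℕ) : ℝ) * pc n k) ≤ (thr k n : ℝ) ^ ((3 : ℝ) / 2) ∧
      (thr k n : ℝ) ^ ((3 : ℝ) / 4) + w + 1 ≤ ((n.choose 2 : ℕ) : ℝ) * pc n k / 4 := by
  have hμ := tendsto_mean hk
  have hm : Tendsto (fun n : ℕ => (thr k n : ℝ)) atTop atTop :=
    tendsto_natCast_atTop_atTop.comp (tendsto_nat_floor_atTop.comp hμ)
  have hm34 : Tendsto (fun n : ℕ => (thr k n : ℝ) ^ ((3 : ℝ) / 4)) atTop atTop :=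
    (tendsto_rpow_atTop (by norm_num)).comp hm
  have hm12 : Tendsto (fun n : ℕ => (thr k n : ℝ) ^ ((1 : ℝ) / 2)) atTop atTop :=
    (tendsto_rpow_atTop (by norm_num)).comp hm
  have hμ14 : Tendsto (fun n : ℕ => (((n.choose 2 : ℕ) : ℝ) * pc n k) ^ ((1 : ℝ) / 4))
      atTop atTop :=
    (tendsto_rpow_atTop (by norm_num)).comp hμ
  have hp := (tendsto_pc (show 2 ≤ k by omega)).eventually
    (eventually_le_nhds (show (0 : ℝ) < 1 / 8 by norm_num))
  filter_upwards [eventually_ge_atTop 1, hp, hm34.eventually_ge_atTop 2,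
    hm12.eventually_ge_atTop 16, hμ14.eventually_ge_atTop 8,
    hμ.eventually_ge_atTop (8 * ((w : ℝ) + 1))] with n hn hp8 h34 h12 h14 hw
  set μ : ℝ := ((n.choose 2 : ℕ) : ℝ) * pc n k with hμdef
  set m : ℕ := thr k n with hmdef
  have hp0 : 0 < pc n k := Real.rpow_pos_of_pos (by exact_mod_cast hn) _
  have hμ0 : 0 ≤ μ := mul_nonneg (Nat.cast_nonneg _) hp0.le
  have hmμ : (m : ℝ) ≤ μ := Nat.floor_le hμ0
  have hμm : μ < m + 1 := Nat.lt_floor_add_one μ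
  have hm0 : (0 : ℝ) < m := by
    rcases Nat.eq_zero_or_pos m with h | h
    · exfalso
      have : (m : ℝ) ^ ((3 : ℝ) / 4) = 0 := by
        rw [h, Nat.cast_zero, Real.zero_rpow (by norm_num)]
      linarith
    · exact_mod_cast h
  have hm1 : (1 : ℝ) ≤ m := by
    have : 0 < m := by exact_mod_cast hm0
    exact_mod_cast this
  refine ⟨hp0, hp8, h34, ?_, ?_⟩
  · -- 8 μ ≤ 8 (m + 1) ≤ 16 m ≤ m^{1/2} m = m^{3/2}
    have hsplit : (m : ℝ) ^ ((3 : ℝ) / 2) = (m : ℝ) ^ ((1 : ℝ) / 2) * m := by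
      rw [show (3 : ℝ) / 2 = 1 / 2 + 1 by norm_num, Real.rpow_add hm0, Real.rpow_one]
    rw [hsplit]
    nlinarith
  · -- m^{3/4} ≤ μ^{3/4} ≤ μ / 8 and w + 1 ≤ μ / 8
    have h1 : (m : ℝ) ^ ((3 : ℝ) / 4) ≤ μ ^ ((3 : ℝ) / 4) :=
      Real.rpow_le_rpow (Nat.cast_nonneg _) hmμ (by norm_num)
    have hμpos : 0 < μ := by linarith [hm1]
    have h2 : μ ^ ((3 : ℝ) / 4) * 8 ≤ μ := by
      calc μ ^ ((3 : ℝ) / 4) * 8 ≤ μ ^ ((3 : ℝ) / 4) * μ ^ ((1 : ℝ) / 4) :=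
            mul_le_mul_of_nonneg_left h14 (Real.rpow_nonneg hμ0 _)
        _ = μ := by
            rw [← Real.rpow_add hμpos, show (3 : ℝ) / 4 + 1 / 4 = 1 by norm_num, Real.rpow_one]
    linarith

/-- **Step conditions on the window.** If `0 < p ≤ 1/8`, `m ≤ μ < m + 1` (`μ = N p`) and
`R + w + 1 ≤ μ / 4`, then every `t` with `m - R - w ≤ t ≤ m + R + w` satisfies `t + 1 ≤ N` and
both one-step ratio conditions. [folklore] -/
theorem window_steps {N m w : ℕ} {p R : ℝ} (hp0 : 0 < p) (hp8 : p ≤ 1 / 8) (hR : 0 ≤ R)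
    (hmμ : (m : ℝ) ≤ N * p) (hμm : (N : ℝ) * p < m + 1) (hwin : R + w + 1 ≤ N * p / 4)
    (t : ℕ) (ht1 : (m : ℝ) - R - w ≤ t) (ht2 : (t : ℝ) ≤ m + R + w) :
    t + 1 ≤ N ∧ ((N : ℝ) - t) * p ≤ 2 * ((t + 1 : ℝ) * (1 - p)) ∧
      (t + 1 : ℝ) * (1 - p) ≤ 2 * (((N : ℝ) - t) * p) := by
  set μ : ℝ := (N : ℝ) * p with hμ
  have ht0 : (0 : ℝ) ≤ t := Nat.cast_nonneg _
  have hw0 : (0 : ℝ) ≤ w := Nat.cast_nonneg _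
  have htup : (t : ℝ) + 1 ≤ 5 * μ / 4 := by linarith
  have htlo : 3 * μ / 4 < (t : ℝ) + 1 := by linarith
  have hμ0 : 0 < μ := by linarith
  have hN0 : (0 : ℝ) < N := by
    by_contra h
    push Not at h
    have : μ ≤ 0 := by rw [hμ]; nlinarith
    linarith
  refine ⟨?_, ?_, ?_⟩
  · have : (t : ℝ) + 1 ≤ N := by nlinarith
    exact_mod_cast this
  · nlinarith
  · have htp : (t : ℝ) * p ≤ 5 * μ / 4 * (1 / 8) :=
      mul_le_mul (by linarith) hp8 hp0.le (by linarith)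
    nlinarith

/-! ### Central mass and band ratios -/

section Window

variable {k w n : ℕ} {b : ℕ → ℝ}

/-- **Central mass.** On the window, the central edge counts `|i - m| ≤ m^{3/4}` carry binomial
mass at least `1/2` (Chebyshev with `t = m^{3/4}/2`). [folklore] -/
theorem half_le_sum_central
    (hb : ∀ i, b i = ((n.choose 2).choose i : ℝ) * pc n k ^ i * (1 - pc n k) ^ (n.choose 2 - i))
    (hp0 : 0 < pc n k) (hp8 : pc n k ≤ 1 / 8) (h34 : (2 : ℝ) ≤ (thr k n : ℝ) ^ ((3 : ℝ) / 4))
    (h32 : 8 * (((n.choose 2 : ℕ) : ℝ) * pc n k) ≤ (thr k n : ℝ) ^ ((3 : ℝ) / 2)) :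
    1 / 2 ≤ ∑ j ∈ (range (n.choose 2 + 1)).filter (fun j => Central k n j), b j := by
  set N : ℕ := n.choose 2 with hN
  set p : ℝ := pc n k with hp
  set μ : ℝ := (N : ℝ) * p with hμdef
  set m : ℕ := thr k n with hmdef
  have hp1 : p ≤ 1 := by linarith
  have hμ0 : 0 ≤ μ := mul_nonneg (Nat.cast_nonneg _) hp0.le
  have hmμ : (m : ℝ) ≤ μ := Nat.floor_le hμ0
  have hμm : μ < m + 1 := Nat.lt_floor_add_one μ
  have hm0 : (0 : ℝ) ≤ m := Nat.cast_nonneg _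
  have htot := binomialWeight_sum_range hb
  have hsplit := sum_filter_add_sum_filter_not (range (N + 1)) (fun j => Central k n j) b
  -- Chebyshev on the non-central indices
  set t : ℝ := (m : ℝ) ^ ((3 : ℝ) / 4) / 2 with htdef
  have ht : 0 < t := by rw [htdef]; linarith
  have htail := binomialWeight_tail_le hb hp0.le hp1 ht (fun i => ¬ Central k n i) (by
    intro i hi
    simp only [Central] at hi
    push Not at hi
    have h1 : |(i : ℝ) - m| ≤ |(i : ℝ) - μ| + |μ - m| := abs_sub_le _ _ _
    have h2 : |μ - (m : ℝ)| < 1 := by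
      rw [abs_lt]; constructor <;> linarith
    rw [htdef]
    change (thr k n : ℝ) ^ ((3 : ℝ) / 4) < |(i : ℝ) - (thr k n : ℝ)| at hi
    linarith)
  have ht2 : t ^ 2 = (m : ℝ) ^ ((3 : ℝ) / 2) / 4 := by
    rw [htdef, div_pow, ← Real.rpow_natCast, ← Real.rpow_mul hm0]
    norm_num
  have hm32 : 0 < (m : ℝ) ^ ((3 : ℝ) / 2) := by
    have := pow_pos ht 2
    rw [ht2] at this
    linarith
  have hbound : (N : ℝ) * p * (1 - p) / t ^ 2 ≤ 1 / 2 := by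
    rw [ht2, div_le_iff₀ (by positivity)]
    have : (N : ℝ) * p * (1 - p) ≤ μ := by
      rw [hμdef]; nlinarith [mul_nonneg (Nat.cast_nonneg N) hp0.le]
    nlinarith
  linarith

/-- **Band ratios.** On the window, `b j ≤ 2^w · b i` whenever `j` is central and
`i ∈ [j-w, j+w]`. [folklore] -/
theorem binomialWeight_central_le
    (hb : ∀ i, b i = ((n.choose 2).choose i : ℝ) * pc n k ^ i * (1 - pc n k) ^ (n.choose 2 - i))
    (hp0 : 0 < pc n k) (hp8 : pc n k ≤ 1 / 8)
    (hwin : (thr k n : ℝ) ^ ((3 : ℝ) / 4) + w + 1 ≤ ((n.choose 2 : ℕ) : ℝ) * pc n k / 4)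
    {j : ℕ} (hj : Central k n j) {i : ℕ} (hi : i ∈ Icc (j - w) (j + w)) :
    b j ≤ 2 ^ w * b i := by
  set N : ℕ := n.choose 2 with hN
  set p : ℝ := pc n k with hp
  set m : ℕ := thr k n with hmdef
  set R : ℝ := (m : ℝ) ^ ((3 : ℝ) / 4) with hRdef
  have hp1 : p < 1 := by linarith
  have hμ0 : 0 ≤ (N : ℝ) * p := mul_nonneg (Nat.cast_nonneg _) hp0.le
  have hmμ : (m : ℝ) ≤ N * p := Nat.floor_le hμ0
  have hμm : (N : ℝ) * p < m + 1 := Nat.lt_floor_add_one _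
  have hR : 0 ≤ R := Real.rpow_nonneg (Nat.cast_nonneg _) _
  have hsteps := window_steps (w := w) hp0 hp8 hR hmμ hμm hwin
  have hjc : (m : ℝ) - R ≤ j ∧ (j : ℝ) ≤ m + R := by
    have := abs_le.1 hj
    constructor <;> linarith [this.1, this.2]
  rw [mem_Icc] at hi
  have hbi : 0 ≤ b i := binomialWeight_nonneg hb hp0.le hp1.le i
  have hw0 : (0 : ℝ) ≤ w := Nat.cast_nonneg _
  have h2w : ∀ {d : ℕ}, d ≤ w → (2 : ℝ) ^ d * b i ≤ 2 ^ w * b i := fun hd =>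
    mul_le_mul_of_nonneg_right (pow_le_pow_right₀ (by norm_num) hd) hbi
  rcases le_total i j with hij | hji
  · -- `j = i + d`: step up from `i` to `j`
    obtain ⟨d, rfl⟩ : ∃ d, j = i + d := ⟨j - i, by omega⟩
    have hd : d ≤ w := by omega
    have hdR : (d : ℝ) ≤ w := by exact_mod_cast hd
    push_cast at hjc
    refine (binomialWeight_add_le_two_pow_mul hb hp0.le hp1 ?_ ?_).trans (h2w hd)
    · have := (hsteps (i + d) (by push_cast; linarith [hjc.1])
        (by push_cast; linarith [hjc.2])).1
      omega
    · intro t ht1 ht2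
      have ht1' : (i : ℝ) ≤ t := by exact_mod_cast ht1
      have ht2' : (t : ℝ) < i + d := by exact_mod_cast ht2
      exact (hsteps t (by linarith [hjc.1]) (by linarith [hjc.2])).2.1
  · -- `i = j + d`: step down from `j` to `i`
    obtain ⟨d, rfl⟩ : ∃ d, i = j + d := ⟨i - j, by omega⟩
    have hd : d ≤ w := by omega
    have hdR : (d : ℝ) ≤ w := by exact_mod_cast hd
    refine (binomialWeight_le_two_pow_mul_add hb hp0 hp1.le ?_ ?_).trans (h2w hd)
    · have := (hsteps (j + d) (by push_cast; linarith [hjc.1])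
        (by push_cast; linarith [hjc.2])).1
      omega
    · intro t ht1 ht2
      have ht1' : (j : ℝ) ≤ t := by exact_mod_cast ht1
      have ht2' : (t : ℝ) < j + d := by exact_mod_cast ht2
      exact (hsteps t (by linarith [hjc.1]) (by linarith [hjc.2])).2.2

/-- Central edge counts have their whole band below `C(n,2)` on the window. [folklore] -/
theorem central_add_le (hp0 : 0 < pc n k) (hp8 : pc n k ≤ 1 / 8)
    (hwin : (thr k n : ℝ) ^ ((3 : ℝ) / 4) + w + 1 ≤ ((n.choose 2 : ℕ) : ℝ) * pc n k / 4)
    {j : ℕ} (hj : Central k n j) : j + w ≤ n.choose 2 := by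
  have hμ0 : 0 ≤ ((n.choose 2 : ℕ) : ℝ) * pc n k := mul_nonneg (Nat.cast_nonneg _) hp0.le
  have hR : 0 ≤ (thr k n : ℝ) ^ ((3 : ℝ) / 4) := Real.rpow_nonneg (Nat.cast_nonneg _) _
  have hjc := abs_le.1 hj
  have hmμ : (thr k n : ℝ) ≤ ((n.choose 2 : ℕ) : ℝ) * pc n k := Nat.floor_le hμ0
  have hμm : ((n.choose 2 : ℕ) : ℝ) * pc n k < (thr k n : ℝ) + 1 := Nat.lt_floor_add_one _
  have hw0 : (0 : ℝ) ≤ w := Nat.cast_nonneg _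
  have h := (window_steps (w := w) hp0 hp8 hR hmμ hμm hwin
    (j + w) (by push_cast; linarith [hjc.1]) (by push_cast; linarith [hjc.2])).1
  omega

end Window

/-! ### The averaging step and the implication -/

/-- **Some central band is accurate.** On the window, every circuit `C` has a central edge count
`j` whose band error is at most `2^{w+1}(2w+1)` times its `G(n,p)`-error. [folklore] -/
theorem exists_central_bandErr_le {k w n : ℕ} (hp0 : 0 < pc n k) (hp8 : pc n k ≤ 1 / 8)
    (h34 : (2 : ℝ) ≤ (thr k n : ℝ) ^ ((3 : ℝ) / 4))
    (h32 : 8 * (((n.choose 2 : ℕ) : ℝ) * pc n k) ≤ (thr k n : ℝ) ^ ((3 : ℝ) / 2))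
    (hwin : (thr k n : ℝ) ^ ((3 : ℝ) / 4) + w + 1 ≤ ((n.choose 2 : ℕ) : ℝ) * pc n k / 4)
    (C : Circuit (Edge n)) :
    ∃ j : ℕ, Central k n j ∧ bandErr n k j w C ≤ 2 ^ (w + 1) * (2 * w + 1) * err n k C := by
  set b : ℕ → ℝ := fun i =>
    ((n.choose 2).choose i : ℝ) * pc n k ^ i * (1 - pc n k) ^ (n.choose 2 - i) with hbdef
  have hb : ∀ i,
      b i = ((n.choose 2).choose i : ℝ) * pc n k ^ i * (1 - pc n k) ^ (n.choose 2 - i) :=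
    fun i => rfl
  set f : ℕ → ℝ := fun i =>
    (#(errSet n k i C) : ℝ) / (#(ConstantBand.Negative.slice n i) : ℝ) with hfdef
  have hp1 : pc n k ≤ 1 := by linarith
  obtain ⟨j, hjS, hj⟩ := exists_mem_band_sum_le
    (S := (range (n.choose 2 + 1)).filter fun j => Central k n j) (N := n.choose 2) (w := w)
    (b := b) (f := f) (K := 2 ^ w) (ε := err n k C)
    (binomialWeight_nonneg hb hp0.le hp1)
    (fun i => div_nonneg (Nat.cast_nonneg _) (Nat.cast_nonneg _)) (by positivity)
    (half_le_sum_central hb hp0 hp8 h34 h32)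
    (fun j hj => central_add_le hp0 hp8 hwin (mem_filter.1 hj).2)
    (fun j hj i hi => binomialWeight_central_le hb hp0 hp8 hwin (mem_filter.1 hj).2 hi)
    (by
      rw [show err n k C = gnpProb n (pc n k)
          (univ.filter fun x : Edge n → Bool => C.eval x ≠ cliqueFn n k x) from rfl,
        ← sum_binomialWeight_mul_errFrac n k (pc n k) C])
  refine ⟨j, (mem_filter.1 hjS).2, ?_⟩
  rw [show bandErr n k j w C = ∑ i ∈ Icc (j - w) (j + w), f i from rfl]
  calc ∑ i ∈ Icc (j - w) (j + w), f i ≤ 2 * 2 ^ w * (2 * w + 1) * err n k C := hj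
    _ = 2 ^ (w + 1) * (2 * w + 1) * err n k C := by ring

/-- **`ConstantBand` at `(c, k, w, δ)` gives `SingleThreshold` at `(c, k, δ / (2^{w+1}(2w+1)))`.**
[folklore] -/
theorem lowerBoundAt_of_bandLB {c k w : ℕ} {δ : ℝ} (hk : 3 ≤ k) (H : BandLB c k w δ) :
    LowerBoundAt c k (δ / (2 ^ (w + 1) * (2 * w + 1))) := by
  have hK : (0 : ℝ) < 2 ^ (w + 1) * (2 * w + 1) := by positivity
  filter_upwards [H, eventually_window hk w] with n hn hwin C hC herr
  obtain ⟨hp0, hp8, h34, h32, hwin5⟩ := hwin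
  obtain ⟨j, hjc, hj⟩ := exists_central_bandErr_le (w := w) hp0 hp8 h34 h32 hwin5 C
  refine hn j hjc C hC (hj.trans ?_)
  rw [le_div_iff₀ hK] at herr
  linarith

/-- **Item stmt-PneNP-2839** (`BandImpliesThreshold`, route PneNP/OneSlice): the constant-width
band rung implies Rossman's single-threshold rung — `ConstantBand → SingleThreshold`. -/
theorem bandImpliesThreshold_proof :
    Summit.PneNP.PneNP.Theses.OneSlice.BandImpliesThreshold := by
  intro hBand
  rw [singleThreshold_iff_lib]
  intro c
  obtain ⟨k, hk, w, δ, hδ, H⟩ := constantBand_iff.1 hBand c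
  exact ⟨k, hk, δ / (2 ^ (w + 1) * (2 * w + 1)), by positivity, lowerBoundAt_of_bandLB hk H⟩

end

end Summit.PneNP.PneNP.Theorems
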